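import Mathlib
import Summits.ValiantsHypothesis.ValiantsHypothesis.Theses.BarrierLever
import Summits.ValiantsHypothesis.ValiantsHypothesis.Theorems.BarrierLeverPrincipalMinorLayoutsNonsingularRefutation
import Summits.ValiantsHypothesis.ValiantsHypothesis.Theorems.BarrierLeverTransversalSufficesForPrincipal

/-!
# Route BarrierLever — item `TransversalMinorLayoutsNonsingular` (stmt-ValiantsHypothesis-19152): REFUTATION

Refutation file (`--workitem stmt-ValiantsHypothesis-19152`; cell valiant-natproofs, rung V4, 𝒟-side;
prover seat val-np-p3 gen 4). Definition-free; a corollary of the refutation of TNS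
(`TNSRefutation.not_PrincipalMinorLayoutsNonsingular`, item 19126: at `h = 31` the layout
`u = (∅, {0}, …, {30})`, `w =` all subsets of `{0,…,4}` has a singular principal-minor layout
matrix for EVERY `K`) through arrows already in the tree.

**`not_TransversalMinorLayoutsNonsingular`**: conjecture TT is false, since TT ⇒ TNS is the proved item 19153
(`TransversalDictionary.transversalSufficesForPrincipal`) and TNS is false.

WHAT THIS IS NOT: item 19717 `PartitionMinorsHitByVP` (layout-dependent witnesses) is untouched;
nothing on crux stmt-14610 or `VP` vs `VNP`.
-/

set_option linter.dupNamespace false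

namespace Summit.ValiantsHypothesis.ValiantsHypothesis.Theorems.BarrierLever.TNSRefutation

/-- **TT is false** (item `TransversalMinorLayoutsNonsingular`, stmt-ValiantsHypothesis-19152): by the
proved arrow TT ⇒ TNS (item 19153, `TransversalDictionary.transversalSufficesForPrincipal`) and the
refutation of TNS (`not_PrincipalMinorLayoutsNonsingular`). -/
theorem not_TransversalMinorLayoutsNonsingular :
    ¬ Summit.ValiantsHypothesis.ValiantsHypothesis.Theses.BarrierLever.TransversalMinorLayoutsNonsingular :=
  fun hTT => not_PrincipalMinorLayoutsNonsingular
    (TransversalDictionary.transversalSufficesForPrincipal hTT)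

end Summit.ValiantsHypothesis.ValiantsHypothesis.Theorems.BarrierLever.TNSRefutation
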